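import Summits.QuantumFields.YangMills.Theorems.FluctuationComparisonRegPrIntLOrganTangentBidiscMixedDifference
import Summits.QuantumFields.YangMills.Theorems.FluctuationComparisonRegPrIntLOrganTangentSeedHClause
import Summits.QuantumFields.YangMills.Theorems.FluctuationComparisonRegPrIntLOrganTangentHClauseAlgebra
import HarnessLib

/-!
# THE (C2) LAST MILE, BY KERNEL: a V-LOCAL POLYMER-ANALYTIC presentation `f = c + Σ_X act X` on the `θ`-window ⟹ the `∃ k`-BLOCK of
# O1ᵘ-H's output clause (`HClauseSq` letters with a `κ`-weighted row mass) — [Balaban1987RG1] (0.21)–(0.26)'s currency feeding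
# `stub_oneStepTransportUH`'s output text; def-free

Cell `ym3-torus` (YM ladder rung R3 = continuum `SU(2)` Yang–Mills on the three-torus — a RUNG: NOT d = 4, NOT infinite volume, NOT a mass
gap, NOT Clay).  LEAD-20520 width seat `ym-ust-20520-w3` (gen 28), LEAD №3 CLAIM (2026-08-31T14:29Z); `--kind proof --supports stmt-QuantumFields-20520
--as helper`, count-neutral, definition-free, default heartbeats, `autoImplicit false`; no registry ∕ binder ∕ `Lines/` ∕ row edit (registry
`Lines/semiclassical_s2beta.lean` 3732b7df UNTOUCHED; `Lines/runpair_organ.lean` v18.9, ROW-sq v0.4 untouched).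

WHAT THIS IS.  DISCHARGE-SPEC v1.7 §11 (xi)∕(xv) names the print-shaped supplier of `stub_oneStepTransportUH`'s OUTPUT clause on the (C2)
«integrate before you differentiate» road: the transported difference `h_j − ct` presented as ONE function with a LOCALISED expansion
([Balaban1987RG1] Thm 1 (0.22)–(0.26): `E = Σ_X E(X,·)`, `E(X,·)` depending on the field through `X` only, analytic on the complex small-field
domain, `‖·‖_κ`-summable), after which «`HClauseSq` follows by the landed bidisc Cauchy doors».  This file makes that sentence a theorem:
* §1 ★`hClauseSq_of_analyticPairWindowAt` — the PURE-ANALYTIC door: the (β) predicate `AnalyticPairWindowAt θ r B f` (text inlined) ⟹ the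
  scaled one-bond-pair clause with the CONSTANT letter `8B∕r²` at cap `r∕4` (✓`…BidiscMixedDifference.abs_mixedDiff_le_scaled_real` +
  ✓`…SeedHClause`'s normalisation lemmas; the seed-free sibling of ✓`hClauseSq_of_seed_of_analytic` — no interpolation, no `ωT`).
* §2 ★`fourPt_eq_zero_of_local` — V-LOCALITY KILLS THE FAR SQUARES EXACTLY (`b ∉ S ∨ b′ ∉ S` ⟹ `a Z − a V − a W + a U = 0`; [Balaban1987RG1]
  (0.22); the `HClauseSq`-currency twin of the registry line's `fourPoint_le_of_polymerNorm` cancellation — shape mirrored, nothing copied into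
  or out of `Lines/`); ★`hClauseSq_indicator_of_local` — a constant letter `K` refines to `K·𝟙[b ∈ S ∧ b′ ∈ S]`.
* §3 ★★`block_of_polymerClauses` — polymers `X ∈ T` (supports `supp X`, letters `K X ≥ 0`, local activities with constant-letter clauses),
  `f = c + Σ_{X ∈ T} act X` on the window ⟹ THE BLOCK `∃ k, (∀ b b′, 0 ≤ k b b′) ∧ (∀ b, Σ_{b′} k b b′·e^{κ·tdist} ≤ N) ∧ ⟨clause θ r k f⟩`,
  `k b b′ := Σ_X K X·𝟙[b,b′ ∈ supp X]`, under the SHARP norm `∀ b, Σ_{X ∋ b} K X·Σ_{b′ ∈ supp X} e^{κ·tdist(b,b′)} ≤ N`;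
  ★★`block_of_polymerClauses_len` — the same under print's `‖·‖_κ` shape `∀ b, Σ_{X ∋ b} K X·#supp X·e^{κ·len X} ≤ N` (`len X ≥ diam`, `0 ≤ κ`).
* §4 ★★★`block_of_polymerAnalytic` ∕ `…_len` — §1 ∘ §3: per-polymer (β) with oscillation `wt X ≥ 0` ⟹ the block at cap `r∕4`, `K X := 8·wt X∕r²`.
WHY (branch-free w.r.t. LEAD RULING №55's FL-36c fork): on «≥ 1.70» this is the door through which the (C2) SUM letter feeds
`stub_oneStepTransportUH`'s output clause VERBATIM; on «≤ 1.35» it is the recombined statement the covariant organ must reproduce; on BETWEEN it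
is SPEC (xv)'s no-regret artefact.  WHAT THIS IS NOT: that `h_j − ct` HAS such a presentation with an m-uniform norm is [Balaban1987RG1] Thm 1's
content for ONE run and is NOT in print for the SU(2) two-run difference (UV3-NODE §83; [King1986] Thm 3.4 is the abelian anchor) — nothing of
Bałaban's analysis is asserted or proved here; `SpreadFibreLawH(J)(sq)`, `OrganDischargeInputsHJ(sq)` v0.1–v0.4 UNDISCHARGED; O1ᵘ-H, S1aᴴ,
S2α′, S2β, 26243, the five registered stubs, crux 20520 `FluctuationComparisonRegPrIntL` and `YM3TorusSU2` are NOT proved; no summit ∕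
sub-problem statement is proved by a helper; rung R3 = SU(2) YM₃ on T³ at fixed lattice data — NOT d = 4, NOT infinite volume, NOT a mass gap,
NOT Clay; the Yang–Mills mass gap is NOT proved.  [folklore] complex analysis + finite sums.  Credit: px19 g22 (bidisc Cauchy), LEAD w3 g24∕g25
(seed door, KIT), `ym-line-cst-p1` g41 (`HClauseSq` algebra), ideator g26 (CURRENCY-MEMO), the registry line's polymer calculus.
-/

set_option autoImplicit false

noncomputable section

open Function Metric Set
open Literature.MathematicalPhysics.QuantumFieldTheory.Balaban1983to89
open T4CubeChartExp (expPt)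
open Summit.QuantumFields.YangMills.Theorems.OrganTangentBidiscMixedDifference (abs_mixedDiff_le_scaled_real)
open Summit.QuantumFields.YangMills.Theorems.OrganTangentSeedHClause (smul_normalize_eq norm_normalize_le eq_update_of_rel)
open Summit.QuantumFields.YangMills.Theorems.OrganTangentHClauseAlgebra (hClauseSq_congr hClauseSq_sum hClauseSq_add_const)
open scoped BigOperators

namespace Summit.QuantumFields.YangMills.Theorems.OrganTangentHClauseBlockOfPolymerAnalytic

variable {P : Params} {j : ℕ}

/-! ## §1 The pure-analytic door: (β) ⟹ the clause with a constant letter `8B∕r²` at cap `r∕4` -/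

section Analytic

variable [DecidableEq (PBond P j)]

/-- ★ **(β) ⟹ `HClauseSq` WITH THE CONSTANT LETTER `8B∕r²` AT CAP `r∕4`**: under `AnalyticPairWindowAt θ r B f` (inlined), for raw moves
`‖v‖, ‖v′‖ ≤ (r∕4)·θ` and the relational square `V = U·e^{v}@b`, `W = U·e^{v′}@b′`, `Z = V·e^{v′}@b′` in the `θ`-window,
`|f Z − f V − f W + f U| ≤ (8B∕r²)·(‖v‖∕θ)·(‖v′‖∕θ)` (normalise `v = ‖v‖•w`, read the corners off (β)'s representation clause, apply
✓`abs_mixedDiff_le_scaled_real`; degenerate moves give `0 ≤ 0`). [cite: Balaban1985UV3, p.263] -/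
theorem hClauseSq_of_analyticPairWindowAt {θ r B : ℝ} (hθ : 0 < θ) (hr : 0 < r)
    {f : GaugeField P j (Matrix.specialUnitaryGroup (Fin 2) ℂ) → ℝ}
    (hβ : ∀ U : GaugeField P j (Matrix.specialUnitaryGroup (Fin 2) ℂ), PlaqSmall θ U →
      ∀ (b b' : PBond P j) (w w' : Fin 3 → ℝ), ‖w‖ ≤ 1 → ‖w'‖ ≤ 1 →
        ∃ g : ℂ × ℂ → ℂ, DifferentiableOn ℂ g (ball (0 : ℂ) (r * θ) ×ˢ ball (0 : ℂ) (r * θ)) ∧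
          (∀ (s t : ℝ) (V Z : GaugeField P j (Matrix.specialUnitaryGroup (Fin 2) ℂ)), |s| < r * θ → |t| < r * θ →
            (∀ e, e ≠ b → V e = U e) → V b = U b * expPt (s • w) → (∀ e, e ≠ b' → Z e = V e) → Z b' = V b' * expPt (t • w') →
            g ((s : ℂ), (t : ℂ)) = ((f Z : ℝ) : ℂ)) ∧
          ∀ z ∈ ball (0 : ℂ) (r * θ) ×ˢ ball (0 : ℂ) (r * θ), ‖g z - g 0‖ ≤ B) :
    ∀ (b b' : PBond P j) (v v' : Fin 3 → ℝ) (U V W Z : GaugeField P j (Matrix.specialUnitaryGroup (Fin 2) ℂ)),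
      ‖v‖ ≤ r / 4 * θ → ‖v'‖ ≤ r / 4 * θ → PlaqSmall θ U → PlaqSmall θ V → PlaqSmall θ W → PlaqSmall θ Z →
      (∀ e, e ≠ b → V e = U e) → V b = U b * expPt v → (∀ e, e ≠ b' → W e = U e) → W b' = U b' * expPt v' →
      (∀ e, e ≠ b' → Z e = V e) → Z b' = V b' * expPt v' →
      |f Z - f V - f W + f U| ≤ 8 * B / r ^ 2 * (‖v‖ / θ) * (‖v'‖ / θ) := by
  intro b b' v v' U V W Z hv hv' hU _hV _hW _hZ hVU hVb hWU hWb hZV hZb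
  have hrθ : 0 < r * θ := mul_pos hr hθ
  have hVeq := eq_update_of_rel hVU hVb; have hWeq := eq_update_of_rel hWU hWb; have hZeq := eq_update_of_rel hZV hZb
  -- degenerate moves
  by_cases hv0 : v = 0
  · have hVU' : V = U := by
      rw [hVeq]; funext e; by_cases he : e = b
      · subst he; rw [update_self, hv0, T4CubeChartExp.expPt_zero, mul_one]
      · rw [update_of_ne he]
    have hZW : Z = W := by
      rw [hZeq, hWeq, hVU']
    rw [hZW, hVU', hv0, norm_zero, zero_div]
    simp
  by_cases hv0' : v' = 0
  · have hWU' : W = U := by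
      rw [hWeq]; funext e; by_cases he : e = b'
      · subst he; rw [update_self, hv0', T4CubeChartExp.expPt_zero, mul_one]
      · rw [update_of_ne he]
    have hZV' : Z = V := by
      rw [hZeq]; funext e; by_cases he : e = b'
      · subst he; rw [update_self, hv0', T4CubeChartExp.expPt_zero, mul_one]
      · rw [update_of_ne he]
    rw [hZV', hWU', hv0', norm_zero, zero_div]
    simp
  -- normalise the directions: `v = s • w`, `v' = t • w'` with sup-norm-unit `w, w'`
  set w : Fin 3 → ℝ := ‖v‖⁻¹ • v with hw_def
  set w' : Fin 3 → ℝ := ‖v'‖⁻¹ • v' with hw'_def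
  have hw : ‖w‖ ≤ 1 := norm_normalize_le hv0; have hw' : ‖w'‖ ≤ 1 := norm_normalize_le hv0'
  have hsv : ‖v‖ • w = v := smul_normalize_eq hv0; have htv : ‖v'‖ • w' = v' := smul_normalize_eq hv0'
  set s : ℝ := ‖v‖ with hs_def
  set t : ℝ := ‖v'‖ with ht_def
  have hs0 : 0 ≤ s := norm_nonneg v; have ht0 : 0 ≤ t := norm_nonneg v'
  have hs4 : |s| ≤ r * θ / 4 := by rw [abs_of_nonneg hs0]; linarith
  have ht4 : |t| ≤ r * θ / 4 := by rw [abs_of_nonneg ht0]; linarith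
  have hslt : |s| < r * θ := lt_of_le_of_lt hs4 (by linarith)
  have htlt : |t| < r * θ := lt_of_le_of_lt ht4 (by linarith)
  have h0lt : |(0 : ℝ)| < r * θ := by rw [abs_zero]; exact hrθ
  obtain ⟨g, hg, hrep, hB⟩ := hβ U hU b b' w w' hw hw'
  -- the four corners off the representation clause
  have hVb' : V b = U b * expPt (s • w) := by rw [hsv]; exact hVb
  have hZb' : Z b' = V b' * expPt (t • w') := by rw [htv]; exact hZb
  have hWb' : W b' = U b' * expPt (t • w') := by rw [htv]; exact hWb
  have gZ : g ((s : ℂ), (t : ℂ)) = ((f Z : ℝ) : ℂ) := hrep s t V Z hslt htlt hVU hVb' hZV hZb'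
  have gV : g ((s : ℂ), 0) = ((f V : ℝ) : ℂ) := by
    have := hrep s 0 V V hslt h0lt hVU hVb' (fun e _ => rfl) (by rw [zero_smul, T4CubeChartExp.expPt_zero, mul_one])
    rwa [Complex.ofReal_zero] at this
  have gW : g (0, (t : ℂ)) = ((f W : ℝ) : ℂ) := by
    have := hrep 0 t U W h0lt htlt (fun e _ => rfl) (by rw [zero_smul, T4CubeChartExp.expPt_zero, mul_one]) hWU hWb'
    rwa [Complex.ofReal_zero] at this
  have gU : g (0, 0) = ((f U : ℝ) : ℂ) := by
    have := hrep 0 0 U U h0lt h0lt (fun e _ => rfl) (by rw [zero_smul, T4CubeChartExp.expPt_zero, mul_one]) (fun e _ => rfl)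
      (by rw [zero_smul, T4CubeChartExp.expPt_zero, mul_one])
    rwa [Complex.ofReal_zero] at this
  have key := abs_mixedDiff_le_scaled_real hθ hr hg hB hs4 ht4 gZ gV gW gU
  rw [abs_of_nonneg hs0, abs_of_nonneg ht0] at key
  exact key

end Analytic

/-! ## §2 V-locality kills the far squares exactly -/

section Local

variable {S : Finset (PBond P j)} {a : GaugeField P j (Matrix.specialUnitaryGroup (Fin 2) ℂ) → ℝ}
  {b b' : PBond P j} {v v' : Fin 3 → ℝ} {U V W Z : GaugeField P j (Matrix.specialUnitaryGroup (Fin 2) ℂ)}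

/-- ★ **A SUPPORT MISSING `b` OR `b′` KILLS THE RELATIONAL SQUARE**: if `a` depends on the configuration only through the bonds of `S`
(`(∀ e ∈ S, U e = U′ e) → a U = a U′`) and `b ∉ S ∨ b′ ∉ S`, then `a Z − a V − a W + a U = 0` for the square `V = U·g@b`, `W = U·g′@b′`,
`Z = V·g′@b′` (any group elements; the value `V b` is immaterial, its binder is kept for plug-compatibility with the clause text).  [Balaban1987RG1] (0.22)'s «E(X,·) depends on the field restricted to X» used exactly as in the registry
line's polymer calculus. [cite: Balaban1987RG1, (0.22)] -/
theorem fourPt_eq_zero_of_local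
    (hloc : ∀ U U' : GaugeField P j (Matrix.specialUnitaryGroup (Fin 2) ℂ), (∀ e ∈ S, U e = U' e) → a U = a U')
    (hS : b ∉ S ∨ b' ∉ S) {g g' : Matrix.specialUnitaryGroup (Fin 2) ℂ}
    (hVU : ∀ e, e ≠ b → V e = U e) (_hVb : V b = U b * g) (hWU : ∀ e, e ≠ b' → W e = U e) (hWb : W b' = U b' * g')
    (hZV : ∀ e, e ≠ b' → Z e = V e) (hZb : Z b' = V b' * g') :
    a Z - a V - a W + a U = 0 := by
  rcases hS with hb | hb'
  · -- `b ∉ S`: `V ≡ U` and `Z ≡ W` on `S`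
    have e1 : a V = a U := hloc V U fun e he => hVU e (fun h => hb (h ▸ he))
    have e2 : a Z = a W := by
      refine hloc Z W fun e he => ?_
      have hne : e ≠ b := fun h => hb (h ▸ he)
      by_cases heb' : e = b'
      · subst heb'
        rw [hZb, hWb, hVU _ (Ne.symm (fun h => hne h.symm))]
      · rw [hZV e heb', hVU e hne, hWU e heb']
    rw [e1, e2]; ring
  · -- `b′ ∉ S`: `W ≡ U` and `Z ≡ V` on `S`
    have e1 : a W = a U := hloc W U fun e he => hWU e (fun h => hb' (h ▸ he))
    have e2 : a Z = a V := hloc Z V fun e he => hZV e (fun h => hb' (h ▸ he))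
    rw [e1, e2]; ring

/-- ★ **CONSTANT LETTER ⟹ INDICATOR LETTER**: an `S`-local `a` satisfying the clause with a constant letter `K` satisfies it with the letter
`K·𝟙[b ∈ S ∧ b′ ∈ S]` (off the indicator the square vanishes by ★`fourPt_eq_zero_of_local`). [cite: Balaban1987RG1, (0.22)] -/
theorem hClauseSq_indicator_of_local [DecidableEq (PBond P j)] {θ r K : ℝ}
    (hloc : ∀ U U' : GaugeField P j (Matrix.specialUnitaryGroup (Fin 2) ℂ), (∀ e ∈ S, U e = U' e) → a U = a U')
    (h : ∀ (b b' : PBond P j) (v v' : Fin 3 → ℝ) (U V W Z : GaugeField P j (Matrix.specialUnitaryGroup (Fin 2) ℂ)),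
      ‖v‖ ≤ r * θ → ‖v'‖ ≤ r * θ → PlaqSmall θ U → PlaqSmall θ V → PlaqSmall θ W → PlaqSmall θ Z →
      (∀ e, e ≠ b → V e = U e) → V b = U b * expPt v → (∀ e, e ≠ b' → W e = U e) → W b' = U b' * expPt v' →
      (∀ e, e ≠ b' → Z e = V e) → Z b' = V b' * expPt v' →
      |a Z - a V - a W + a U| ≤ K * (‖v‖ / θ) * (‖v'‖ / θ)) :
    ∀ (b b' : PBond P j) (v v' : Fin 3 → ℝ) (U V W Z : GaugeField P j (Matrix.specialUnitaryGroup (Fin 2) ℂ)),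
      ‖v‖ ≤ r * θ → ‖v'‖ ≤ r * θ → PlaqSmall θ U → PlaqSmall θ V → PlaqSmall θ W → PlaqSmall θ Z →
      (∀ e, e ≠ b → V e = U e) → V b = U b * expPt v → (∀ e, e ≠ b' → W e = U e) → W b' = U b' * expPt v' →
      (∀ e, e ≠ b' → Z e = V e) → Z b' = V b' * expPt v' →
      |a Z - a V - a W + a U| ≤ (if b ∈ S ∧ b' ∈ S then K else 0) * (‖v‖ / θ) * (‖v'‖ / θ) := by
  intro b b' v v' U V W Z hv hv' hU hV hW hZ e1 e2 e3 e4 e5 e6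
  by_cases hbb : b ∈ S ∧ b' ∈ S
  · rw [if_pos hbb]
    exact h b b' v v' U V W Z hv hv' hU hV hW hZ e1 e2 e3 e4 e5 e6
  · rw [if_neg hbb]
    have hS : b ∉ S ∨ b' ∉ S := by
      by_cases hb : b ∈ S
      · exact Or.inr fun hb' => hbb ⟨hb, hb'⟩
      · exact Or.inl hb
    rw [fourPt_eq_zero_of_local hloc hS e1 e2 e3 e4 e5 e6, abs_zero]
    simp

end Local

/-! ## §3 The polymer sum: per-polymer constant letters + locality ⟹ the `∃ k`-BLOCK with a `κ`-weighted row mass -/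

section Block

variable [DecidableEq (PBond P j)] {ι : Type*} {θ r κ N : ℝ}

/-- Row mass of the indicator letters: `Σ_{b′} (Σ_{X ∈ T} K X·𝟙[b,b′ ∈ supp X])·e^{κ·tdist(b,b′)} = Σ_{X ∈ T, b ∈ supp X} K X·Σ_{b′ ∈ supp X} e^{κ·tdist(b,b′)}`
(exchange of two finite sums). [folklore] -/
theorem rowMass_indicator_eq (T : Finset ι) (supp : ι → Finset (PBond P j)) (K : ι → ℝ) (b : PBond P j) :
    ∑ b', (∑ X ∈ T, if b ∈ supp X ∧ b' ∈ supp X then K X else 0) * Real.exp (κ * (b.src.tdist b'.src : ℝ)) =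
      ∑ X ∈ T.filter (fun X => b ∈ supp X), K X * ∑ b' ∈ supp X, Real.exp (κ * (b.src.tdist b'.src : ℝ)) := by
  classical
  calc ∑ b', (∑ X ∈ T, if b ∈ supp X ∧ b' ∈ supp X then K X else 0) * Real.exp (κ * (b.src.tdist b'.src : ℝ))
      = ∑ b', ∑ X ∈ T, (if b ∈ supp X ∧ b' ∈ supp X then K X else 0) * Real.exp (κ * (b.src.tdist b'.src : ℝ)) := by
        refine Finset.sum_congr rfl fun b' _ => ?_
        rw [Finset.sum_mul]
    _ = ∑ X ∈ T, ∑ b', (if b ∈ supp X ∧ b' ∈ supp X then K X else 0) * Real.exp (κ * (b.src.tdist b'.src : ℝ)) :=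
        Finset.sum_comm
    _ = ∑ X ∈ T, (if b ∈ supp X then K X * ∑ b' ∈ supp X, Real.exp (κ * (b.src.tdist b'.src : ℝ)) else 0) := by
        refine Finset.sum_congr rfl fun X _ => ?_
        by_cases hb : b ∈ supp X
        · rw [if_pos hb]
          have hterm : ∀ b' : PBond P j,
              (if b ∈ supp X ∧ b' ∈ supp X then K X else 0) * Real.exp (κ * (b.src.tdist b'.src : ℝ)) =
                if b' ∈ supp X then K X * Real.exp (κ * (b.src.tdist b'.src : ℝ)) else 0 := by
            intro b'
            by_cases hb' : b' ∈ supp X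
            · rw [if_pos ⟨hb, hb'⟩, if_pos hb']
            · rw [if_neg (fun h => hb' h.2), if_neg hb', zero_mul]
          rw [Finset.sum_congr rfl (fun b' _ => hterm b'), ← Finset.sum_filter, Finset.mul_sum]
          refine Finset.sum_congr ?_ fun b' _ => rfl
          ext b'; simp
        · rw [if_neg hb]
          refine Finset.sum_eq_zero fun b' _ => ?_
          rw [if_neg (fun h => hb h.1), zero_mul]
    _ = ∑ X ∈ T.filter (fun X => b ∈ supp X), K X * ∑ b' ∈ supp X, Real.exp (κ * (b.src.tdist b'.src : ℝ)) := by
        rw [Finset.sum_filter]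

/-- ★★ **THE BLOCK FROM PER-POLYMER CLAUSES** (sharp norm): polymers `X ∈ T` with supports `supp X`, letters `K X ≥ 0`, `supp X`-LOCAL
activities with the constant-letter clause on the `θ`-window, `f = c + Σ_{X ∈ T} act X` on the window, and the norm hypothesis
`∀ b, Σ_{X ∈ T, b ∈ supp X} K X·Σ_{b′ ∈ supp X} e^{κ·tdist(b,b′)} ≤ N` ⟹ THE `∃ k`-BLOCK of O1ᵘ-H's output clause for `f` with
`k b b′ := Σ_{X ∈ T} K X·𝟙[b ∈ supp X ∧ b′ ∈ supp X]` (✓`hClauseSq_sum` over ★`hClauseSq_indicator_of_local`, ✓`hClauseSq_add_const`,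
✓`hClauseSq_congr`). [cite: Balaban1987RG1, (0.23)-(0.26)] -/
theorem block_of_polymerClauses (T : Finset ι) (supp : ι → Finset (PBond P j)) (K : ι → ℝ)
    (act : ι → GaugeField P j (Matrix.specialUnitaryGroup (Fin 2) ℂ) → ℝ) (c : ℝ)
    {f : GaugeField P j (Matrix.specialUnitaryGroup (Fin 2) ℂ) → ℝ}
    (hK : ∀ X ∈ T, 0 ≤ K X)
    (hloc : ∀ X ∈ T, ∀ U U' : GaugeField P j (Matrix.specialUnitaryGroup (Fin 2) ℂ), (∀ e ∈ supp X, U e = U' e) → act X U = act X U')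
    (hcl : ∀ X ∈ T, ∀ (b b' : PBond P j) (v v' : Fin 3 → ℝ) (U V W Z : GaugeField P j (Matrix.specialUnitaryGroup (Fin 2) ℂ)),
      ‖v‖ ≤ r * θ → ‖v'‖ ≤ r * θ → PlaqSmall θ U → PlaqSmall θ V → PlaqSmall θ W → PlaqSmall θ Z →
      (∀ e, e ≠ b → V e = U e) → V b = U b * expPt v → (∀ e, e ≠ b' → W e = U e) → W b' = U b' * expPt v' →
      (∀ e, e ≠ b' → Z e = V e) → Z b' = V b' * expPt v' →
      |act X Z - act X V - act X W + act X U| ≤ K X * (‖v‖ / θ) * (‖v'‖ / θ))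
    (hf : ∀ U, PlaqSmall θ U → f U = c + ∑ X ∈ T, act X U)
    (hN : ∀ b : PBond P j, ∑ X ∈ T.filter (fun X => b ∈ supp X), K X * ∑ b' ∈ supp X, Real.exp (κ * (b.src.tdist b'.src : ℝ)) ≤ N) :
    ∃ k : PBond P j → PBond P j → ℝ, (∀ b b', 0 ≤ k b b') ∧
      (∀ b, ∑ b', k b b' * Real.exp (κ * (b.src.tdist b'.src : ℝ)) ≤ N) ∧
      ∀ (b b' : PBond P j) (v v' : Fin 3 → ℝ) (U V W Z : GaugeField P j (Matrix.specialUnitaryGroup (Fin 2) ℂ)),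
        ‖v‖ ≤ r * θ → ‖v'‖ ≤ r * θ → PlaqSmall θ U → PlaqSmall θ V → PlaqSmall θ W → PlaqSmall θ Z →
        (∀ e, e ≠ b → V e = U e) → V b = U b * expPt v → (∀ e, e ≠ b' → W e = U e) → W b' = U b' * expPt v' →
        (∀ e, e ≠ b' → Z e = V e) → Z b' = V b' * expPt v' →
        |f Z - f V - f W + f U| ≤ k b b' * (‖v‖ / θ) * (‖v'‖ / θ) := by
  classical
  refine ⟨fun b b' => ∑ X ∈ T, if b ∈ supp X ∧ b' ∈ supp X then K X else 0, ?_, ?_, ?_⟩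
  · intro b b'
    refine Finset.sum_nonneg fun X hX => ?_
    split_ifs
    · exact hK X hX
    · exact le_refl _
  · intro b
    rw [rowMass_indicator_eq]
    exact hN b
  · -- the clause: sum over polymers, add the constant, transfer to `f` on the window
    have hsum := hClauseSq_sum (θ := θ) (r := r) T
      (Rf := act) (kf := fun X b b' => if b ∈ supp X ∧ b' ∈ supp X then K X else 0)
      (fun X hX => hClauseSq_indicator_of_local (hloc X hX) (hcl X hX))
    have hc := hClauseSq_add_const (θ := θ) (r := r) c hsum
    have hfin := hClauseSq_congr (θ := θ) (r := r) (R := fun U => (∑ X ∈ T, act X U) + c) (R' := f)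
      (k := fun b b' => ∑ X ∈ T, (fun X b b' => if b ∈ supp X ∧ b' ∈ supp X then K X else 0) X b b')
      (k' := fun b b' => ∑ X ∈ T, if b ∈ supp X ∧ b' ∈ supp X then K X else 0)
      hc (fun U hU => by rw [hf U hU, add_comm]) (fun b b' => le_refl _)
    exact hfin

omit [DecidableEq (PBond P j)] in
/-- `Σ_{b′ ∈ S} e^{κ·tdist(b,b′)} ≤ #S·e^{κ·ℓ}` when `b ∈ S`, `0 ≤ κ` and `ℓ` bounds the `tdist`-diameter of `S`. [folklore] -/
theorem sum_exp_tdist_le_card_mul {S : Finset (PBond P j)} {b : PBond P j} {ℓ : ℝ} (hκ : 0 ≤ κ) (hb : b ∈ S)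
    (hdiam : ∀ e ∈ S, ∀ e' ∈ S, (e.src.tdist e'.src : ℝ) ≤ ℓ) :
    ∑ b' ∈ S, Real.exp (κ * (b.src.tdist b'.src : ℝ)) ≤ (S.card : ℝ) * Real.exp (κ * ℓ) := by
  calc ∑ b' ∈ S, Real.exp (κ * (b.src.tdist b'.src : ℝ)) ≤ ∑ _b' ∈ S, Real.exp (κ * ℓ) :=
        Finset.sum_le_sum fun b' hb' => Real.exp_le_exp.mpr (mul_le_mul_of_nonneg_left (hdiam b hb b' hb') hκ)
    _ = (S.card : ℝ) * Real.exp (κ * ℓ) := by rw [Finset.sum_const, nsmul_eq_mul]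

/-- ★★ **THE BLOCK FROM PER-POLYMER CLAUSES, `‖·‖_κ` FORM**: as ★★`block_of_polymerClauses` with the norm hypothesis in print's shape
`∀ b, Σ_{X ∈ T, b ∈ supp X} K X·#supp X·e^{κ·len X} ≤ N`, `len X ≥` the `tdist`-diameter of `supp X`, `0 ≤ κ` (the `#supp X` counts the
partners `b′` of `b` inside `X`). [cite: Balaban1987RG1, (0.23)-(0.26)] -/
theorem block_of_polymerClauses_len (T : Finset ι) (supp : ι → Finset (PBond P j)) (len K : ι → ℝ)
    (act : ι → GaugeField P j (Matrix.specialUnitaryGroup (Fin 2) ℂ) → ℝ) (c : ℝ)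
    {f : GaugeField P j (Matrix.specialUnitaryGroup (Fin 2) ℂ) → ℝ} (hκ : 0 ≤ κ)
    (hK : ∀ X ∈ T, 0 ≤ K X)
    (hdiam : ∀ X ∈ T, ∀ e ∈ supp X, ∀ e' ∈ supp X, (e.src.tdist e'.src : ℝ) ≤ len X)
    (hloc : ∀ X ∈ T, ∀ U U' : GaugeField P j (Matrix.specialUnitaryGroup (Fin 2) ℂ), (∀ e ∈ supp X, U e = U' e) → act X U = act X U')
    (hcl : ∀ X ∈ T, ∀ (b b' : PBond P j) (v v' : Fin 3 → ℝ) (U V W Z : GaugeField P j (Matrix.specialUnitaryGroup (Fin 2) ℂ)),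
      ‖v‖ ≤ r * θ → ‖v'‖ ≤ r * θ → PlaqSmall θ U → PlaqSmall θ V → PlaqSmall θ W → PlaqSmall θ Z →
      (∀ e, e ≠ b → V e = U e) → V b = U b * expPt v → (∀ e, e ≠ b' → W e = U e) → W b' = U b' * expPt v' →
      (∀ e, e ≠ b' → Z e = V e) → Z b' = V b' * expPt v' →
      |act X Z - act X V - act X W + act X U| ≤ K X * (‖v‖ / θ) * (‖v'‖ / θ))
    (hf : ∀ U, PlaqSmall θ U → f U = c + ∑ X ∈ T, act X U)
    (hN : ∀ b : PBond P j, ∑ X ∈ T.filter (fun X => b ∈ supp X), K X * ((supp X).card : ℝ) * Real.exp (κ * len X) ≤ N) :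
    ∃ k : PBond P j → PBond P j → ℝ, (∀ b b', 0 ≤ k b b') ∧
      (∀ b, ∑ b', k b b' * Real.exp (κ * (b.src.tdist b'.src : ℝ)) ≤ N) ∧
      ∀ (b b' : PBond P j) (v v' : Fin 3 → ℝ) (U V W Z : GaugeField P j (Matrix.specialUnitaryGroup (Fin 2) ℂ)),
        ‖v‖ ≤ r * θ → ‖v'‖ ≤ r * θ → PlaqSmall θ U → PlaqSmall θ V → PlaqSmall θ W → PlaqSmall θ Z →
        (∀ e, e ≠ b → V e = U e) → V b = U b * expPt v → (∀ e, e ≠ b' → W e = U e) → W b' = U b' * expPt v' →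
        (∀ e, e ≠ b' → Z e = V e) → Z b' = V b' * expPt v' →
        |f Z - f V - f W + f U| ≤ k b b' * (‖v‖ / θ) * (‖v'‖ / θ) := by
  classical
  refine block_of_polymerClauses T supp K act c hK hloc hcl hf fun b => ?_
  refine le_trans (Finset.sum_le_sum fun X hX => ?_) (hN b)
  have hb : b ∈ supp X := (Finset.mem_filter.mp hX).2
  have hXT : X ∈ T := (Finset.mem_filter.mp hX).1
  rw [mul_assoc]
  exact mul_le_mul_of_nonneg_left (sum_exp_tdist_le_card_mul hκ hb (hdiam X hXT)) (hK X hXT)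

end Block

/-! ## §4 The composition: per-polymer (β) ⟹ the block at cap `r∕4` -/

section PolymerAnalytic

variable [DecidableEq (PBond P j)] {ι : Type*} {θ r κ N : ℝ}

/-- ★★★ **THE (C2) LAST MILE**: a V-LOCAL POLYMER-ANALYTIC presentation of `f` on the `θ`-window (polymers `X ∈ T`, supports `supp X`,
`supp X`-local activities each satisfying (β) `AnalyticPairWindowAt θ r (wt X) (act X)` (inlined), `wt X ≥ 0`, `f = c + Σ_{X ∈ T} act X` on the
window, sharp norm `∀ b, Σ_{X ∋ b} (8·wt X∕r²)·Σ_{b′ ∈ supp X} e^{κ·tdist(b,b′)} ≤ N`) YIELDS THE `∃ k`-BLOCK of `stub_oneStepTransportUH`'s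
output clause for `f` at window `θ`, cap `r∕4`, mass `N` (★§1 per polymer ∘ ★★§3).  Nothing of Bałaban's is proved: that the transported
two-run difference HAS such a presentation is the (C2) road's debt. [cite: Balaban1987RG1, (0.22)-(0.26); Balaban1985UV3, p.263] -/
theorem block_of_polymerAnalytic (hθ : 0 < θ) (hr : 0 < r) (T : Finset ι) (supp : ι → Finset (PBond P j)) (wt : ι → ℝ)
    (act : ι → GaugeField P j (Matrix.specialUnitaryGroup (Fin 2) ℂ) → ℝ) (c : ℝ)
    {f : GaugeField P j (Matrix.specialUnitaryGroup (Fin 2) ℂ) → ℝ}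
    (hwt : ∀ X ∈ T, 0 ≤ wt X)
    (hloc : ∀ X ∈ T, ∀ U U' : GaugeField P j (Matrix.specialUnitaryGroup (Fin 2) ℂ), (∀ e ∈ supp X, U e = U' e) → act X U = act X U')
    (hβ : ∀ X ∈ T, ∀ U : GaugeField P j (Matrix.specialUnitaryGroup (Fin 2) ℂ), PlaqSmall θ U →
      ∀ (b b' : PBond P j) (w w' : Fin 3 → ℝ), ‖w‖ ≤ 1 → ‖w'‖ ≤ 1 →
        ∃ g : ℂ × ℂ → ℂ, DifferentiableOn ℂ g (ball (0 : ℂ) (r * θ) ×ˢ ball (0 : ℂ) (r * θ)) ∧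
          (∀ (s t : ℝ) (V Z : GaugeField P j (Matrix.specialUnitaryGroup (Fin 2) ℂ)), |s| < r * θ → |t| < r * θ →
            (∀ e, e ≠ b → V e = U e) → V b = U b * expPt (s • w) → (∀ e, e ≠ b' → Z e = V e) → Z b' = V b' * expPt (t • w') →
            g ((s : ℂ), (t : ℂ)) = ((act X Z : ℝ) : ℂ)) ∧
          ∀ z ∈ ball (0 : ℂ) (r * θ) ×ˢ ball (0 : ℂ) (r * θ), ‖g z - g 0‖ ≤ wt X)
    (hf : ∀ U, PlaqSmall θ U → f U = c + ∑ X ∈ T, act X U)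
    (hN : ∀ b : PBond P j,
      ∑ X ∈ T.filter (fun X => b ∈ supp X), (8 * wt X / r ^ 2) * ∑ b' ∈ supp X, Real.exp (κ * (b.src.tdist b'.src : ℝ)) ≤ N) :
    ∃ k : PBond P j → PBond P j → ℝ, (∀ b b', 0 ≤ k b b') ∧
      (∀ b, ∑ b', k b b' * Real.exp (κ * (b.src.tdist b'.src : ℝ)) ≤ N) ∧
      ∀ (b b' : PBond P j) (v v' : Fin 3 → ℝ) (U V W Z : GaugeField P j (Matrix.specialUnitaryGroup (Fin 2) ℂ)),
        ‖v‖ ≤ r / 4 * θ → ‖v'‖ ≤ r / 4 * θ → PlaqSmall θ U → PlaqSmall θ V → PlaqSmall θ W → PlaqSmall θ Z →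
        (∀ e, e ≠ b → V e = U e) → V b = U b * expPt v → (∀ e, e ≠ b' → W e = U e) → W b' = U b' * expPt v' →
        (∀ e, e ≠ b' → Z e = V e) → Z b' = V b' * expPt v' →
        |f Z - f V - f W + f U| ≤ k b b' * (‖v‖ / θ) * (‖v'‖ / θ) := by
  refine block_of_polymerClauses (θ := θ) (r := r / 4) T supp (fun X => 8 * wt X / r ^ 2) act c
    (fun X hX => div_nonneg (mul_nonneg (by norm_num) (hwt X hX)) (sq_nonneg r)) hloc (fun X hX => ?_) hf hN
  exact hClauseSq_of_analyticPairWindowAt hθ hr (hβ X hX)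

/-- ★★★ **THE (C2) LAST MILE, `‖·‖_κ` FORM**: as ★★★`block_of_polymerAnalytic` with the norm hypothesis in print's shape
`∀ b, Σ_{X ∈ T, b ∈ supp X} (8·wt X∕r²)·#supp X·e^{κ·len X} ≤ N`, `len X ≥` the `tdist`-diameter of `supp X`, `0 ≤ κ`.
[cite: Balaban1987RG1, (0.22)-(0.26); Balaban1985UV3, p.263] -/
theorem block_of_polymerAnalytic_len (hθ : 0 < θ) (hr : 0 < r) (hκ : 0 ≤ κ) (T : Finset ι) (supp : ι → Finset (PBond P j))
    (len wt : ι → ℝ) (act : ι → GaugeField P j (Matrix.specialUnitaryGroup (Fin 2) ℂ) → ℝ) (c : ℝ)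
    {f : GaugeField P j (Matrix.specialUnitaryGroup (Fin 2) ℂ) → ℝ}
    (hwt : ∀ X ∈ T, 0 ≤ wt X)
    (hdiam : ∀ X ∈ T, ∀ e ∈ supp X, ∀ e' ∈ supp X, (e.src.tdist e'.src : ℝ) ≤ len X)
    (hloc : ∀ X ∈ T, ∀ U U' : GaugeField P j (Matrix.specialUnitaryGroup (Fin 2) ℂ), (∀ e ∈ supp X, U e = U' e) → act X U = act X U')
    (hβ : ∀ X ∈ T, ∀ U : GaugeField P j (Matrix.specialUnitaryGroup (Fin 2) ℂ), PlaqSmall θ U →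
      ∀ (b b' : PBond P j) (w w' : Fin 3 → ℝ), ‖w‖ ≤ 1 → ‖w'‖ ≤ 1 →
        ∃ g : ℂ × ℂ → ℂ, DifferentiableOn ℂ g (ball (0 : ℂ) (r * θ) ×ˢ ball (0 : ℂ) (r * θ)) ∧
          (∀ (s t : ℝ) (V Z : GaugeField P j (Matrix.specialUnitaryGroup (Fin 2) ℂ)), |s| < r * θ → |t| < r * θ →
            (∀ e, e ≠ b → V e = U e) → V b = U b * expPt (s • w) → (∀ e, e ≠ b' → Z e = V e) → Z b' = V b' * expPt (t • w') →
            g ((s : ℂ), (t : ℂ)) = ((act X Z : ℝ) : ℂ)) ∧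
          ∀ z ∈ ball (0 : ℂ) (r * θ) ×ˢ ball (0 : ℂ) (r * θ), ‖g z - g 0‖ ≤ wt X)
    (hf : ∀ U, PlaqSmall θ U → f U = c + ∑ X ∈ T, act X U)
    (hN : ∀ b : PBond P j, ∑ X ∈ T.filter (fun X => b ∈ supp X), (8 * wt X / r ^ 2) * ((supp X).card : ℝ) * Real.exp (κ * len X) ≤ N) :
    ∃ k : PBond P j → PBond P j → ℝ, (∀ b b', 0 ≤ k b b') ∧
      (∀ b, ∑ b', k b b' * Real.exp (κ * (b.src.tdist b'.src : ℝ)) ≤ N) ∧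
      ∀ (b b' : PBond P j) (v v' : Fin 3 → ℝ) (U V W Z : GaugeField P j (Matrix.specialUnitaryGroup (Fin 2) ℂ)),
        ‖v‖ ≤ r / 4 * θ → ‖v'‖ ≤ r / 4 * θ → PlaqSmall θ U → PlaqSmall θ V → PlaqSmall θ W → PlaqSmall θ Z →
        (∀ e, e ≠ b → V e = U e) → V b = U b * expPt v → (∀ e, e ≠ b' → W e = U e) → W b' = U b' * expPt v' →
        (∀ e, e ≠ b' → Z e = V e) → Z b' = V b' * expPt v' →
        |f Z - f V - f W + f U| ≤ k b b' * (‖v‖ / θ) * (‖v'‖ / θ) := by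
  refine block_of_polymerClauses_len (θ := θ) (r := r / 4) T supp len (fun X => 8 * wt X / r ^ 2) act c hκ
    (fun X hX => div_nonneg (mul_nonneg (by norm_num) (hwt X hX)) (sq_nonneg r)) hdiam hloc (fun X hX => ?_) hf hN
  exact hClauseSq_of_analyticPairWindowAt hθ hr (hβ X hX)

end PolymerAnalytic

end Summit.QuantumFields.YangMills.Theorems.OrganTangentHClauseBlockOfPolymerAnalytic

end
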